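import Summits.Parity.GeneralizedHardyLittlewood.Theorems.LiouvilleShiftedTablesPairsToGHLStubSingles
import Summits.Parity.GeneralizedHardyLittlewood.Theorems.LiouvilleShiftedTablesPairsToGHLStubSlopedEuler
import Summits.Parity.GeneralizedHardyLittlewood.Theorems.LiouvilleShiftedTablesPairsToGHLStubToBounded
import Summits.Parity.GeneralizedHardyLittlewood.Theorems.LiouvilleShiftedTablesPairsToGHLStubRung
import Summits.Parity.GeneralizedHardyLittlewood.Theorems.LiouvilleShiftedTablesPairsToGHLStubRungAtoms
import Summits.Parity.GeneralizedHardyLittlewood.Theorems.LiouvilleShiftedTablesPairsToGHLStubRungLevel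
import Summits.Parity.GeneralizedHardyLittlewood.Theorems.LiouvilleShiftedTablesPairsToGHLStubRungMain
import Summits.Parity.GeneralizedHardyLittlewood.Theorems.LiouvilleShiftedTablesPairsToGHLPairSlice
import Summits.Parity.GeneralizedHardyLittlewood.Theorems.PairsToGHL.Negative.ShiftPairDictionary
import Summits.Parity.GeneralizedHardyLittlewood.Theses.TwinMinorArcs

/-!
# Sloped ladder — the ENGINE theorem: tuple level + one-Liouville atoms ⟹ Hardy–Littlewood for every fixed system

Route `LiouvilleShiftedTables` (Parity / GeneralizedHardyLittlewood), crux stmt-Parity-9389 (`PairsToGHL`), line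
`sloped_ladder` (Cruxes/PairsToGHL/Lines/sloped_ladder.lean).  With the four theorem-grade stubs of the line landed
(`stub_singles`, `stub_slopedEuler`, `stub_rungAtomsPart` / `stub_rungLevelPart` / `stub_rungMainPart` /
`stub_slopedRung`, `stub_toBounded`), Bombieri's asymptotic sieve runs as an induction on the number of forms
(`Nat.le_induction`, base `t = 1` = the prime number theorem in progressions) and yields, SORRY-FREE and with no
unproved named fact:

* `stub_slopedLadderEngine` — the prepared split's child `SlopedLadderEngine`: for all `t ≥ 1`, relative tuple
  level of distribution (`Level_t`, the conclusion of `stub_slopedLevel`) and one-Liouville-factor atoms (`Atoms_t`,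
  the conclusion of `stub_slopedAtoms`) for every `t` imply elementary Hardy–Littlewood
  `Σ_{n ≤ N} ∏ᵢ Λ(aᵢ n + bᵢ) = 𝔖(Φ) N + o(N)` for EVERY fixed positive non-degenerate one-dimensional system;
* `boundedDickson_of_ladderInputs` — hence `TwinMinorArcs.BoundedDickson` (stmt-Parity-13151 verbatim: any signs,
  every convex `K ⊆ [-N, N]`, main term `β_∞ ∏_p β_p`), by `stub_toBounded`;
* `pairsHL_of_ladderInputs` — hence Hardy–Littlewood PAIRS at every fixed shift (`LiouvilleShiftedTables.PairsHL`,
  stmt-Parity-9387), the `t = 2` unit-slope instance (Green–Tao dictionary of `(n, n+h)`).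

So the crux `PairsToGHL` (≡ `PairsHL → DimOne`) is reduced by this line to exactly: the two Siegel-inert conjecture
INPUTS (`stub_slopedLevel`, `stub_slopedAtoms`) and the shift-lift RESIDUAL `stub_shiftLift : BoundedDickson → DimOne`
(Landau–Siegel-complete).  Sources: E. Bombieri, *The asymptotic sieve* (1975/76); B. Green, T. Tao, *Linear equations
in primes*, Ann. of Math. 171 (2010), Conj. 1.2; G. H. Hardy, J. E. Littlewood, *Partitio Numerorum III* (1923). [folklore]
-/

namespace Summit.Parity.GeneralizedHardyLittlewood.Theorems.PairsToGHL.SlopedLadder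

/-- **Registered stub `stub_slopedLadderEngine` (the prepared split's child `SlopedLadderEngine`).** For all
`t ≥ 1`: relative tuple level `Level_t` and one-Liouville-factor atoms `Atoms_t` (for every `t`) imply elementary
Hardy–Littlewood for every fixed positive non-degenerate `t`-system.  Induction on `t`: base `stub_singles`; step
`stub_slopedRung` fed by `stub_rungAtomsPart` (atoms input), `stub_rungLevelPart` (level input for the tail system,
`isNondegenerateSystem_tail`), `stub_rungMainPart` (inductive hypothesis + `stub_slopedEuler`).
[cite: BombieriAsymptoticSieve1976, Theorem 1] -/
theorem stub_slopedLadderEngine : (∀ t : ℕ, 1 ≤ t → ∀ Φ : Fin t → Literature.NumberTheory.Sieve.AffLinForm 1, Literature.NumberTheory.Sieve.IsNondegenerateSystem Φ → (∀ i, 0 < (Φ i).coeff 0 ∧ 0 ≤ (Φ i).const) → (∀ δ : ℝ, 0 < δ → ∀ B : ℝ, ∃ C : ℝ, ∀ N : ℕ, 2 ≤ N → ∀ y r : ℕ → ℕ, (∀ d, y d ≤ N) → (∑ d ∈ Finset.Icc 1 ⌊(N : ℝ) ^ (1 - δ)⌋₊, |(∑ n ∈ (Finset.Icc 1 (y d)).filter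 (fun n : ℕ => n ≡ r d [MOD d]), ∏ i, Literature.NumberTheory.Sieve.intVonMangoldt ((Φ i).eval ![(n : ℤ)])) - (if ∀ i, Int.gcd ((Φ i).eval ![(r d : ℤ)]) d = 1 then ((((Finset.range d).filter (fun ρ : ℕ => ∀ i, Int.gcd ((Φ i).eval ![(ρ : ℤ)]) d = 1)).card : ℝ))⁻¹ else 0) * ∑ n ∈ Finset.Icc 1 (y d), ∏ i, Literature.NumberTheory.Sieve.intVonMangoldt ((Φ i).eval ![(n : ℤ)])|) ≤ C * N / Real.log N ^ B)) →       (∀ t : ℕ, 1 ≤ t → ∀ (Φ : Fin t → Literature.NumberTheory.Sieve.AffLinForm 1) (ψ : Literature.NumberTheory.Sieve.AffLinForm 1), Literature.NumberTheory.Sieve.IsNondegenerateSystem (Matrix.vecCons ψ Φ) → (∀ i, 0 < (Φ i).coeff 0 ∧ 0 ≤ (Φ i).const) → (0 < ψ.coeff 0 ∧ 0 ≤ ψ.const) → (∃ ε₀ : ℝ, 0 < ε₀ ∧ ∀ A : ℝ, 0 < A → ∃ C : ℝ, ∃ N₀ : ℕ, ∀ N : ℕ, N₀ ≤ N → ∀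 w y : ℕ → ℕ, (∀ q, y q ≤ N) → (∑ q ∈ Finset.Icc 1 ⌊(N : ℝ) ^ ε₀⌋₊, |∑ n ∈ (Finset.Icc 1 (y q)).filter (fun n : ℕ => n ≡ w q [MOD q]), (ArithmeticFunction.liouville (Int.toNat (ψ.eval ![(n : ℤ)])) : ℝ) * ∏ i, Literature.NumberTheory.Sieve.intVonMangoldt ((Φ i).eval ![(n : ℤ)])|) ≤ C * N / Real.log N ^ A)) →       ∀ t : ℕ, 1 ≤ t → ∀ Φ : Fin t → Literature.NumberTheory.Sieve.AffLinForm 1, Literature.NumberTheory.Sieve.IsNondegenerateSystem Φ → (∀ i, 0 < (Φ i).coeff 0 ∧ 0 ≤ (Φ i).const) → ((fun N : ℕ => ∑ n ∈ Finset.Icc 1 N, ∏ i, Literature.NumberTheory.Sieve.intVonMangoldt ((Φ i).eval ![(n : ℤ)]) - Literature.NumberTheory.Sieve.singularProduct Φ * N) =o[Filter.atTop] fun N : ℕ => (N : ℝ)) := by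
  intro hL hA t ht
  induction t, ht using Nat.le_induction with
  | base => exact stub_singles
  | succ t ht ih =>
      exact stub_slopedRung t ht
        (fun Φ ψ hn hp hq => stub_rungAtomsPart t ht Φ ψ hn hp hq (hA t ht Φ ψ hn hp hq))
        (fun Φ ψ hn hp hq => stub_rungLevelPart t ht Φ ψ hn hp hq
          (hL t ht Φ (isNondegenerateSystem_tail Φ ψ hn) hp))
        (fun Φ ψ hn hp hq => stub_rungMainPart t ht Φ ψ hn hp hq
          (ih Φ (isNondegenerateSystem_tail Φ ψ hn) hp) (stub_slopedEuler t ht Φ ψ hn hp hq))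

/-- **`BoundedDickson` from the ladder inputs.** Relative tuple level + one-Liouville atoms (all `t`) imply
Dickson–Hardy–Littlewood for every FIXED non-degenerate one-dimensional system in Green–Tao normalisation
(`TwinMinorArcs.BoundedDickson`, stmt-Parity-13151, verbatim) — `stub_toBounded ∘ stub_slopedLadderEngine`.
[cite: GreenTao2010, Conj. 1.2] -/
theorem boundedDickson_of_ladderInputs
    (hL : ∀ t : ℕ, 1 ≤ t → ∀ Φ : Fin t → Literature.NumberTheory.Sieve.AffLinForm 1, Literature.NumberTheory.Sieve.IsNondegenerateSystem Φ → (∀ i, 0 < (Φ i).coeff 0 ∧ 0 ≤ (Φ i).const) → (∀ δ : ℝ, 0 < δ → ∀ B : ℝ, ∃ C : ℝ, ∀ N : ℕ, 2 ≤ N → ∀ y r : ℕ → ℕ, (∀ d, y d ≤ N) → (∑ d ∈ Finset.Icc 1 ⌊(N : ℝ) ^ (1 - δ)⌋₊, |(∑ n ∈ (Finset.Icc 1 (y d)).filter (fun n : ℕ => n ≡ r d [MOD d]), ∏ i, Literature.NumberTheory.Sieve.intVonMangoldt ((Φ i).eval ![(n : ℤ)])) - (if ∀ i, Int.gcd ((Φ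 i).eval ![(r d : ℤ)]) d = 1 then ((((Finset.range d).filter (fun ρ : ℕ => ∀ i, Int.gcd ((Φ i).eval ![(ρ : ℤ)]) d = 1)).card : ℝ))⁻¹ else 0) * ∑ n ∈ Finset.Icc 1 (y d), ∏ i, Literature.NumberTheory.Sieve.intVonMangoldt ((Φ i).eval ![(n : ℤ)])|) ≤ C * N / Real.log N ^ B))
    (hA : ∀ t : ℕ, 1 ≤ t → ∀ (Φ : Fin t → Literature.NumberTheory.Sieve.AffLinForm 1) (ψ : Literature.NumberTheory.Sieve.AffLinForm 1), Literature.NumberTheory.Sieve.IsNondegenerateSystem (Matrix.vecCons ψ Φ) → (∀ i, 0 < (Φ i).coeff 0 ∧ 0 ≤ (Φ i).const) → (0 < ψ.coeff 0 ∧ 0 ≤ ψ.const) → (∃ ε₀ : ℝ, 0 < ε₀ ∧ ∀ A : ℝ, 0 < A → ∃ C : ℝ, ∃ N₀ : ℕ, ∀ N : ℕ, N₀ ≤ N → ∀ w y : ℕ → ℕ, (∀ q, y q ≤ N) → (∑ q ∈ Finset.Icc 1 ⌊(N : ℝ) ^ ε₀⌋₊, |∑ n ∈ (Finset.Icc 1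 (y q)).filter (fun n : ℕ => n ≡ w q [MOD q]), (ArithmeticFunction.liouville (Int.toNat (ψ.eval ![(n : ℤ)])) : ℝ) * ∏ i, Literature.NumberTheory.Sieve.intVonMangoldt ((Φ i).eval ![(n : ℤ)])|) ≤ C * N / Real.log N ^ A)) :
    Summit.Parity.GeneralizedHardyLittlewood.Theses.TwinMinorArcs.BoundedDickson :=
  stub_toBounded (stub_slopedLadderEngine hL hA)

open Finset Filter Literature.NumberTheory.Sieve Summit.Parity.GeneralizedHardyLittlewood.Theorems.PairsToGHL
  Summit.Parity.GeneralizedHardyLittlewood.Theorems.PairsToGHL.Negative in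
/-- **Hardy–Littlewood pairs from the ladder inputs.** The `t = 2`, unit-slope, fixed-shift instance:
`Σ_{n ≤ N} Λ(n)Λ(n+h) = 𝔖({0,h}) N + o(N)` for every `h ≥ 1` (`LiouvilleShiftedTables.PairsHL`, stmt-Parity-9387),
by the Green–Tao dictionary of `(n, n+h)` (`Negative.vonMangoldtSum_shiftPairSystem`, `archFactor_shiftPairSystem`,
`singularSeries_pair_eq_singularProduct`). [cite: GreenTao2010, Example 1] -/
theorem pairsHL_of_ladderInputs
    (hL : ∀ t : ℕ, 1 ≤ t → ∀ Φ : Fin t → Literature.NumberTheory.Sieve.AffLinForm 1, Literature.NumberTheory.Sieve.IsNondegenerateSystem Φ → (∀ i, 0 < (Φ i).coeff 0 ∧ 0 ≤ (Φ i).const) → (∀ δ : ℝ, 0 < δ → ∀ B : ℝ, ∃ C : ℝ, ∀ N : ℕ, 2 ≤ N → ∀ y r : ℕ → ℕ, (∀ d, y d ≤ N) → (∑ d ∈ Finset.Icc 1 ⌊(N : ℝ) ^ (1 - δ)⌋₊, |(∑ n ∈ (Finset.Icc 1 (y d)).filter (fun n : ℕ => n ≡ r d [MOD d]), ∏ i,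 Literature.NumberTheory.Sieve.intVonMangoldt ((Φ i).eval ![(n : ℤ)])) - (if ∀ i, Int.gcd ((Φ i).eval ![(r d : ℤ)]) d = 1 then ((((Finset.range d).filter (fun ρ : ℕ => ∀ i, Int.gcd ((Φ i).eval ![(ρ : ℤ)]) d = 1)).card : ℝ))⁻¹ else 0) * ∑ n ∈ Finset.Icc 1 (y d), ∏ i, Literature.NumberTheory.Sieve.intVonMangoldt ((Φ i).eval ![(n : ℤ)])|) ≤ C * N / Real.log N ^ B))
    (hA : ∀ t : ℕ, 1 ≤ t → ∀ (Φ : Fin t → Literature.NumberTheory.Sieve.AffLinForm 1) (ψ : Literature.NumberTheory.Sieve.AffLinForm 1), Literature.NumberTheory.Sieve.IsNondegenerateSystem (Matrix.vecCons ψ Φ) → (∀ i, 0 < (Φ i).coeff 0 ∧ 0 ≤ (Φ i).const) → (0 < ψ.coeff 0 ∧ 0 ≤ ψ.const) → (∃ ε₀ : ℝ, 0 < ε₀ ∧ ∀ A : ℝ, 0 < A → ∃ C : ℝ, ∃ N₀ : ℕ, ∀ N : ℕ, N₀ ≤ N → ∀ w y : ℕ → ℕ, (∀ q, y q ≤ N)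 → (∑ q ∈ Finset.Icc 1 ⌊(N : ℝ) ^ ε₀⌋₊, |∑ n ∈ (Finset.Icc 1 (y q)).filter (fun n : ℕ => n ≡ w q [MOD q]), (ArithmeticFunction.liouville (Int.toNat (ψ.eval ![(n : ℤ)])) : ℝ) * ∏ i, Literature.NumberTheory.Sieve.intVonMangoldt ((Φ i).eval ![(n : ℤ)])|) ≤ C * N / Real.log N ^ A)) :
    Summit.Parity.GeneralizedHardyLittlewood.Theses.LiouvilleShiftedTables.PairsHL := by
  have hB := boundedDickson_of_ladderInputs hL hA
  intro h hh
  have hh0 : h ≠ 0 := by omega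
  rw [Asymptotics.isLittleO_iff]
  intro c hc
  obtain ⟨N₀, hN₀⟩ := hB 2 (shiftPairSystem (h : ℤ)) (by norm_num)
    (isNondegenerateSystem_shiftPairSystem_iff.mpr (by exact_mod_cast hh0)) c hc
  rw [Filter.eventually_atTop]
  refine ⟨N₀, fun N hN => ?_⟩
  have hGN := hN₀ N hN (realBox 1 N) (convex_Icc _ _) subset_rfl
  rw [vonMangoldtSum_shiftPairSystem, archFactor_shiftPairSystem,
    ← singularSeries_pair_eq_singularProduct hh0] at hGN
  rw [Real.norm_eq_abs, Real.norm_eq_abs, Nat.abs_cast, mul_comm (singularSeries _) (N : ℝ)]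
  exact hGN

end Summit.Parity.GeneralizedHardyLittlewood.Theorems.PairsToGHL.SlopedLadder
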